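import Summits.HodgeConjecture.CorCM.MumfordTateRankThreefolds
import Summits.HodgeConjecture.CorCM.MumfordTateRankSimpleSurfacesSharp
import Summits.HodgeConjecture.CorCM.MumfordTateRankEllipticProducts
import HarnessLib

/-!
# Dimension `g ≤ 3`: the maximal Mumford–Tate rank `g(2g+1) + 1` is attained exactly when `End⁰X = ℚ`, and then
# `Lie Hg(H¹X) = 𝔰𝔭_{2g}` (Moonen–Zarhin 1999 (2.1)–(2.3), Type I(1): «`Hg(X) = Sp(V, φ) ≅ Sp_{2g,ℚ}`» for `g ≤ 3`)

COR-CM (cell `pub-hodgecm2`, seat `b27` gen 46, count-neutral Mumford–Tate-rank ladder; theorems only, no definition, no named fact;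
UNCONDITIONAL — nothing here uses or asserts HC_CM).  The uniform statement behind the curve / surface / threefold tables of the lane
(`CorCM/MumfordTateRankEllipticProducts`, `…SimpleSurfacesSharp`, `…Threefolds`): for EVERY complex abelian variety `X` of dimension
`g ∈ {1, 2, 3}`,

* **`mtRank_hodge_one_eq_max_iff_of_dim_le_three`** — `dim MT(H¹X) = g(2g+1) + 1 ⟺ dim_ℚ End⁰X = 1` (values `4`, `11`, `22`);
* **`hodgeLie_eq_skewAdjoint_of_finrank_endAlgebra_eq_one_of_dim_le_three`** — `End⁰X = ℚ ⟹ Lie Hg(H¹X) = 𝔰𝔭(H¹X, ψ)` for every polarization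
  (curves: `𝔰𝔩₂` by counting; surfaces: the rank-four Θ-subalgebra theorem; threefolds: the rank-six one — both from cell `pub-hodge-ring2`);
* `not_isOfCMType_of_finrank_endAlgebra_eq_one`, `mtRank_hodge_one_eq_four_iff_of_curve` (curves: `t = 4 ⟺ End⁰ = ℚ ⟺` not CM).

For `g = 4` this fails (Mumford's fourfolds with `End⁰ = ℚ` and `Hg` a `ℚ`-form of `SL₂³`, `t = 10`; MZ99 (2.4)).

## References
* [MoonenZarhin1999LowDim] B. Moonen, Yu. G. Zarhin, Math. Ann. 315 (1999), §2 (2.1)–(2.4).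
* [Deligne1982HodgeCycles] P. Deligne, LNM 900 (1982), I §3 Prop. 3.6.
* [Humphreys1972] J. E. Humphreys, GTM 9, §1.2 (`dim 𝔰𝔭_{2g} = g(2g+1)`).
-/

noncomputable section

open scoped TensorProduct
open CategoryTheory Module

namespace Summit.HodgeConjecture.CorCM

open Literature.AlgebraicGeometry.Motives
open Literature.AlgebraicGeometry.Motives.AbelianVariety
open Literature.AlgebraicGeometry.Motives.HodgeStructure
open Literature.AlgebraicGeometry.HodgeTheory
open Literature.AlgebraicGeometry.Milne1999 (IsOfCMType)
open Literature.Algebra.Lie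

variable [HodgeTensorFacts.{0, 0}] {X : AbelianVariety ℂ}

/-! ## §1 Curves -/

omit [HodgeTensorFacts.{0, 0}] in
/-- `End⁰X = ℚ` excludes CM type (a CM type needs a commutative subalgebra of `End⁰X` of dimension `2 dim X ≥ 2`). [folklore]
[cite: MoonenZarhin1999LowDim, §2 (2.1)] -/
theorem not_isOfCMType_of_finrank_endAlgebra_eq_one (h0 : 0 < X.dim) (hE1 : Module.finrank ℚ X.endAlgebra = 1) : ¬ IsOfCMType X := by
  rintro ⟨S, -, -, hS⟩
  haveI : Module.Finite ℚ X.endAlgebra := AbelianVariety.finiteDimensional_endAlgebra_holds X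
  have hle : Module.finrank ℚ ↥S ≤ Module.finrank ℚ X.endAlgebra := Submodule.finrank_le (Subalgebra.toSubmodule S)
  omega

/-- **Curves: `dim MT(H¹E) = 4 ⟺ End⁰E = ℚ`** (non-CM: `t = 4`, `End⁰ = ℚ`; CM: `t = 2`). [cite: MoonenZarhin1999LowDim, §2 (2.1)] -/
theorem mtRank_hodge_one_eq_four_iff_of_curve {n : ℕ} (hX : IsSmoothProjective n X.X) (hX1 : X.dim = 1) :
    haveI := BettiUniverse.finite hX 1
    (BettiUniverse.hodge exists_isReal_hodgeModel_holds hX 1).mtRank = 4 ↔ Module.finrank ℚ X.endAlgebra = 1 := by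
  have hk : X.dim = n := schemeDim_eq_holds hX
  subst hk
  by_cases hcm : IsOfCMType X
  · have h2 := mtRank_hodge_one_eq_two_of_cm_curve hX1 hcm
    refine ⟨fun h => ?_, fun h => absurd hcm (not_isOfCMType_of_finrank_endAlgebra_eq_one (by omega) h)⟩
    exact absurd (h2.symm.trans h) (by norm_num)
  · obtain ⟨h4, h1, -⟩ := curve_facts_of_not_isOfCMType hX1 hcm
    exact ⟨fun _ => h1, fun _ => h4⟩

/-! ## §2 The uniform statement in dimension `≤ 3` -/

/-- **For `0 < dim X ≤ 3`: `dim MT(H¹X) = g(2g+1) + 1 ⟺ dim_ℚ End⁰X = 1`** — the maximal (symplectic) rank is attained exactly by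
`End⁰X = ℚ` in dimensions `1, 2, 3` (values `4, 11, 22`; curves: non-CM; surfaces: `CorCM/MumfordTateRankSimpleSurfacesSharp`; threefolds:
`CorCM/MumfordTateRankThreefolds`).  False for `g = 4` (Mumford's examples). [cite: MoonenZarhin1999LowDim, §2 (2.1)–(2.4)] -/
theorem mtRank_hodge_one_eq_max_iff_of_dim_le_three {n : ℕ} (hX : IsSmoothProjective n X.X) (h0 : 0 < X.dim) (h3 : X.dim ≤ 3) :
    haveI := BettiUniverse.finite hX 1
    (BettiUniverse.hodge exists_isReal_hodgeModel_holds hX 1).mtRank = X.dim * (2 * X.dim + 1) + 1 ↔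
      Module.finrank ℚ X.endAlgebra = 1 := by
  haveI := BettiUniverse.finite hX 1
  have hcases : X.dim = 1 ∨ X.dim = 2 ∨ X.dim = 3 := by omega
  rcases hcases with h1 | h2 | h3'
  · have hval : X.dim * (2 * X.dim + 1) + 1 = 4 := by rw [h1]
    rw [hval]
    exact mtRank_hodge_one_eq_four_iff_of_curve hX h1
  · have hval : X.dim * (2 * X.dim + 1) + 1 = 11 := by rw [h2]
    rw [hval]
    exact mtRank_hodge_one_eq_eleven_iff_of_surface hX h2
  · have hval : X.dim * (2 * X.dim + 1) + 1 = 22 := by rw [h3']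
    rw [hval]
    exact mtRank_hodge_one_eq_twentytwo_iff_of_threefold hX h3'

/-- **`End⁰X = ℚ` and `dim X ≤ 3` ⟹ `Lie Hg(H¹X) = 𝔰𝔭(H¹X, ψ)`** for every polarization (Moonen–Zarhin Type I(1) for `g = 1, 2, 3`:
`Hg = SL₂, Sp₄, Sp₆`).  Curves by counting (`dim Lie Hg = 3 = dim 𝔰𝔭₂` inside `Lie Hg ⊆ 𝔰𝔭(ψ)`); surfaces and threefolds by the
Θ-subalgebra theorems of cell `pub-hodge-ring2`. [cite: MoonenZarhin1999LowDim, §2 (2.1)–(2.3)] [cite: Humphreys1972, §1.2] -/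
theorem hodgeLie_eq_skewAdjoint_of_finrank_endAlgebra_eq_one_of_dim_le_three {n : ℕ} (hX : IsSmoothProjective n X.X) (h0 : 0 < X.dim)
    (h3 : X.dim ≤ 3) (hE1 : Module.finrank ℚ X.endAlgebra = 1) [Module.Finite ℚ (bettiCohomology X.X 1)]
    (ψ : (BettiUniverse.hodge exists_isReal_hodgeModel_holds hX 1).Polarization) :
    (BettiUniverse.hodge exists_isReal_hodgeModel_holds hX 1).hodgeLie = ψ.form.skewAdjointSubmodule := by
  classical
  have hcases : X.dim = 1 ∨ X.dim = 2 ∨ X.dim = 3 := by omega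
  rcases hcases with h1 | h2 | h3'
  · -- curves: `Lie Hg ⊆ 𝔰𝔭₂`, both of dimension `3`
    have hle : (BettiUniverse.hodge exists_isReal_hodgeModel_holds hX 1).hodgeLie ≤ ψ.form.skewAdjointSubmodule := by
      intro Y hY
      rw [LinearMap.mem_skewAdjointSubmodule]
      intro v w
      rw [Pi.neg_apply, map_neg, ← add_eq_zero_iff_eq_neg]
      exact form_apply_add_eq_zero_of_mem_hodgeLie ψ hY v w
    have hflip : ψ.form.flip = -ψ.form := by
      rw [ψ.flip_form, show (((1 : ℕ) : ℤ).negOnePow : ℤˣ) = -1 from Int.negOnePow_one, Units.val_neg, Units.val_one,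
        neg_one_zsmul]
    have hs := SymplecticDimension.two_mul_finrank_skewAdjointSubmodule_of_flip_eq_neg ψ.form ψ.nondegenerate hflip
    rw [finrank_bettiCohomology_one_eq_two_mul_dim X, h1] at hs
    have ht := (mtRank_hodge_one_eq_four_iff_of_curve hX h1).2 hE1
    have hH := mtRank_hodge_one_eq_finrank_hodgeLie_add_one hX h0
    refine Submodule.eq_of_le_of_finrank_eq hle ?_
    omega
  · exact hodgeLie_eq_skewAdjoint_of_surface_of_finrank_endAlgebra_eq_one hX h2 hE1 ψ
  · exact hodgeLie_eq_skewAdjoint_of_threefold_of_finrank_endAlgebra_eq_one hX h3' hE1 ψ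

/-- **`End⁰X = ℚ` and `dim X ≤ 3` ⟹ `X` is SIMPLE with `dim MT(H¹X) = g(2g+1) + 1`** (curves trivially; surfaces and threefolds because the
maximal rank exceeds every non-simple rank). [cite: MoonenZarhin1999LowDim, §2 (2.1)–(2.3)] -/
theorem mtRank_hodge_one_eq_max_of_finrank_endAlgebra_eq_one_of_dim_le_three {n : ℕ} (hX : IsSmoothProjective n X.X) (h0 : 0 < X.dim)
    (h3 : X.dim ≤ 3) (hE1 : Module.finrank ℚ X.endAlgebra = 1) :
    haveI := BettiUniverse.finite hX 1
    (BettiUniverse.hodge exists_isReal_hodgeModel_holds hX 1).mtRank = X.dim * (2 * X.dim + 1) + 1 :=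
  (mtRank_hodge_one_eq_max_iff_of_dim_le_three hX h0 h3).2 hE1

end Summit.HodgeConjecture.CorCM

end
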